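import Mathlib
import HarnessLib
import Literature.MathematicalPhysics.QuantumFieldTheory.WilsonPlaquetteWeakCouplingFloor
import Summits.Ventures.LatticeQCDFlow.Scaling.AutoregressiveGaugeAcceptanceCeilingHalf
import Summits.Ventures.LatticeQCDFlow.Scaling.AutoregressiveGaugePlaquetteBallMass

/-!
# LatticeQCDFlow / Scaling — the one-half acceptance ceiling against a plaquette floor:
# `ā ≤ ½ + N(1 − w)/ε² + φ_ρ(ε)/2` for every `w ≤ ⟨(1/N) Re tr U_p⟩_β` and every `ε > 0`, and against the
# tree's volume-uniform weak-coupling floor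

HONEST FRAMING: exact (Metropolis-corrected) sampling algorithms for lattice gauge theory;
figures of merit are autocorrelation/cost numbers at stated couplings and volumes; no
continuum-physics claim.

Venture `LatticeQCDFlow` (cell pub-lqcd), topic `Scaling`, FANOUT row 30 (lean-1, GEN-21) — OUR WORK, the
quantitative sequel of `Scaling/AutoregressiveGaugeAcceptanceCeilingHalf` (`ā ≤ 1 − ½(π_β(B_ε) − φ_ρ(ε))`,
`B_ε = {‖ρ(g) − 1‖ ≤ ε}`, `φ_ρ(ε) = Haar(B_ε)`): Chebyshev on `‖ρ(U_p) − 1‖² = 2(N − Re tr ρ(U_p))`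
(unitary `ρ`, tree `sub_re_trace_eq_half_norm_sub_one_sq`) converts any plaquette floor into a floor on the
Wilson mass of the ball.

## What is proved (all [ours]; unitary continuous `ρ : G → U(N)`, `N ≥ 1`, `L ≥ 2`)

* (Chebyshev input `wilson_ball_mass_ge_of_floor` — `(1/Z)∫ 𝟙_{B_ε}(U_p) e^{−βS_W} dπ ≥ 1 − 2N(1 − w)/ε²` —
  lives in `Scaling/AutoregressiveGaugePlaquetteBallMass`.)
* **`wilson_meanAccept_le_half_add_of_floor`** — under the hypotheses of
  `wilson_meanAccept_le_of_vertexBlind_ball` (a link `e` of the plaquette generated after the other three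
  from a conditional blind to the other links at one endpoint of `e`): `ā ≤ ½ + N(1 − w)/ε² + φ_ρ(ε)/2`.
* **`wilson_meanAccept_le_half_add_linkBall`** (`d ≥ 2`, `β > 0`, radii `r, ε > 0`) — with the tree's
  floor `⟨(1/N) Re tr U_p⟩_β ≥ 1 − 8r²/N + 2 log φ_ρ(r)/((d−1)Nβ)`
  (`Literature/…/WilsonPlaquetteWeakCouplingFloor`): `ā ≤ ½ + (8r² − 2 log φ_ρ(r)/((d−1)β))/ε² + φ_ρ(ε)/2`,
  uniformly in the volume.

READING (value-free): `β → ∞` with `r = β^{−1/2}` at fixed `ε`, then `ε → 0`: the ceiling tends to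
`½ + ½·Haar{ρ(g) = 1}`.  NOT CLAIMED: explicit small-ball masses (group-specific inputs); conditioners
reading both endpoints.  No `def`, no `sorry`, nothing cited as a fact beyond the tree.
-/

noncomputable section

namespace Summit.Ventures.LatticeQCDFlow.Theory2.Autoregressive

open MeasureTheory Function Set
open Literature.MathematicalPhysics.QuantumFieldTheory Literature.MathematicalPhysics.QuantumLattice
open Summit.Ventures.LatticeQCDFlow.Exactness
open scoped Matrix Matrix.Norms.Frobenius

variable {d L N : ℕ} {G : Type*} [Group G] [TopologicalSpace G] [IsTopologicalGroup G]
  [CompactSpace G] [SecondCountableTopology G] [MeasurableSpace G] [BorelSpace G] [NeZero L]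
  (ρ : G →* Matrix (Fin N) (Fin N) ℂ)

/-- **THE CEILING AGAINST A PLAQUETTE FLOOR: `ā ≤ ½ + N(1 − w)/ε² + φ_ρ(ε)/2`** (unitary `ρ`, `N ≥ 1`,
`L ≥ 2`, any `β`, every `ε > 0`, every `w ≤ ⟨(1/N) Re tr ρ(U_p)⟩_β`; hypotheses on `p, e, s, Q, q, y` as in
`wilson_meanAccept_le_of_vertexBlind_ball`). [ours] -/
theorem wilson_meanAccept_le_half_add_of_floor (hN : 1 ≤ N) (hρ : Continuous ρ)
    (hρU : ∀ g, ρ g ∈ Matrix.unitaryGroup (Fin N) ℂ) (hL : 2 ≤ L) (β : ℝ) {ε : ℝ} (hε : 0 < ε)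
    (p : Plaquette d L) {e : Edge d L}
    (he : e ∈ ({(p.1, p.2.1.1), (p.1.shift p.2.1.1, p.2.1.2), (p.1.shift p.2.1.2, p.2.1.1), (p.1, p.2.1.2)} :
      Finset (Edge d L)))
    {s : Finset (Edge d L)}
    (hs : s ⊆ Finset.univ \
      {(p.1, p.2.1.1), (p.1.shift p.2.1.1, p.2.1.2), (p.1.shift p.2.1.2, p.2.1.1), (p.1, p.2.1.2)})
    {Q q : GaugeConfig d L G → ℝ} (hQm : Measurable Q) (hQ0 : ∀ U, 0 ≤ Q U) {CQ : ℝ}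
    (hQb : ∀ U, Q U ≤ CQ) (hQ1 : ∫ U, Q U ∂Measure.pi (fun _ : Edge d L => haarProbability G) = 1)
    (hqm : Measurable q) (hq0 : ∀ U, 0 ≤ q U) {Cq : ℝ} (hqb : ∀ U, q U ≤ Cq)
    (hq1 : ∀ U, ∫ v, q (update U e v) ∂(haarProbability G) = 1)
    (hfac : ∀ U, coordAvg (haarProbability G) s Q U =
      q U * coordAvg (haarProbability G) (insert e s) Q U)
    {y : Site d L} (hy : e.1 = y ∨ e.1.shift e.2 = y)
    (hqB : ∀ e' : Edge d L, e'.1 = y ∨ e'.1.shift e'.2 = y → e' ≠ e →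
      ∀ (U : GaugeConfig d L G) (v : G), q (update U e' v) = q U)
    {w : ℝ} (hw : w ≤ wilsonExpectation ρ β
      (fun U : GaugeConfig d L G => (N : ℝ)⁻¹ * (ρ (plaquetteHolonomy U p.1 p.2.1.1 p.2.1.2)).trace.re)) :
    ∫ U, ∫ V, min
        (Real.exp (-β * wilsonAction ρ U) /
            (∫ W, Real.exp (-β * wilsonAction ρ W) ∂Measure.pi (fun _ : Edge d L => haarProbability G)) *
          Q V)
        (Real.exp (-β * wilsonAction ρ V) /
            (∫ W, Real.exp (-β * wilsonAction ρ W) ∂Measure.pi (fun _ : Edge d L => haarProbability G)) *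
          Q U)
        ∂Measure.pi (fun _ : Edge d L => haarProbability G)
        ∂Measure.pi (fun _ : Edge d L => haarProbability G) ≤
      1 / 2 + N * (1 - w) / ε ^ 2 + (haarProbability G).real {g : G | ‖ρ g - 1‖ ≤ ε} / 2 := by
  have h1 := wilson_meanAccept_le_of_vertexBlind_ball (d := d) (L := L) ρ hρ hL β ε p he hs hQm hQ0 hQb
    hQ1 hqm hq0 hqb hq1 hfac hy hqB
  have h2 := wilson_ball_mass_ge_of_floor (d := d) (L := L) ρ hN hρ hρU β hε p hw
  have e : (1 : ℝ) / 2 + N * (1 - w) / ε ^ 2 + (haarProbability G).real {g : G | ‖ρ g - 1‖ ≤ ε} / 2 =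
      1 - 1 / 2 * ((1 - 2 * N * (1 - w) / ε ^ 2) - (haarProbability G).real {g : G | ‖ρ g - 1‖ ≤ ε}) := by
    ring
  rw [e]
  linarith

/-- **THE CEILING AGAINST THE WEAK-COUPLING FLOOR: `ā ≤ ½ + (8r² − 2 log φ_ρ(r)/((d−1)β))/ε² + φ_ρ(ε)/2`**
(unitary `ρ`, `N ≥ 1`, `d ≥ 2`, `L ≥ 2`, `β > 0`, every pair of radii `r, ε > 0`; hypotheses on
`p, s, Q, q, y` as in `wilson_meanAccept_le_of_vertexBlind_ball`) — the tree's volume-uniform floor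
`⟨(1/N) Re tr U_p⟩_β ≥ 1 − 8r²/N + 2 log φ_ρ(r)/((d−1)Nβ)` plugged in. [ours] -/
theorem wilson_meanAccept_le_half_add_linkBall (hd : 2 ≤ d) (hN : 1 ≤ N) (hρ : Continuous ρ)
    (hρU : ∀ g, ρ g ∈ Matrix.unitaryGroup (Fin N) ℂ) (hL : 2 ≤ L) {β : ℝ} (hβ : 0 < β)
    {r : ℝ} (hr : 0 < r) {ε : ℝ} (hε : 0 < ε)
    (p : Plaquette d L) {e : Edge d L}
    (he : e ∈ ({(p.1, p.2.1.1), (p.1.shift p.2.1.1, p.2.1.2), (p.1.shift p.2.1.2, p.2.1.1), (p.1, p.2.1.2)} :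
      Finset (Edge d L)))
    {s : Finset (Edge d L)}
    (hs : s ⊆ Finset.univ \
      {(p.1, p.2.1.1), (p.1.shift p.2.1.1, p.2.1.2), (p.1.shift p.2.1.2, p.2.1.1), (p.1, p.2.1.2)})
    {Q q : GaugeConfig d L G → ℝ} (hQm : Measurable Q) (hQ0 : ∀ U, 0 ≤ Q U) {CQ : ℝ}
    (hQb : ∀ U, Q U ≤ CQ) (hQ1 : ∫ U, Q U ∂Measure.pi (fun _ : Edge d L => haarProbability G) = 1)
    (hqm : Measurable q) (hq0 : ∀ U, 0 ≤ q U) {Cq : ℝ} (hqb : ∀ U, q U ≤ Cq)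
    (hq1 : ∀ U, ∫ v, q (update U e v) ∂(haarProbability G) = 1)
    (hfac : ∀ U, coordAvg (haarProbability G) s Q U =
      q U * coordAvg (haarProbability G) (insert e s) Q U)
    {y : Site d L} (hy : e.1 = y ∨ e.1.shift e.2 = y)
    (hqB : ∀ e' : Edge d L, e'.1 = y ∨ e'.1.shift e'.2 = y → e' ≠ e →
      ∀ (U : GaugeConfig d L G) (v : G), q (update U e' v) = q U) :
    ∫ U, ∫ V, min
        (Real.exp (-β * wilsonAction ρ U) /
            (∫ W, Real.exp (-β * wilsonAction ρ W) ∂Measure.pi (fun _ : Edge d L => haarProbability G)) *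
          Q V)
        (Real.exp (-β * wilsonAction ρ V) /
            (∫ W, Real.exp (-β * wilsonAction ρ W) ∂Measure.pi (fun _ : Edge d L => haarProbability G)) *
          Q U)
        ∂Measure.pi (fun _ : Edge d L => haarProbability G)
        ∂Measure.pi (fun _ : Edge d L => haarProbability G) ≤
      1 / 2 + (8 * r ^ 2 - 2 * Real.log ((haarProbability G).real {g : G | ‖ρ g - 1‖ ≤ r}) /
          (((d : ℝ) - 1) * β)) / ε ^ 2 +
        (haarProbability G).real {g : G | ‖ρ g - 1‖ ≤ ε} / 2 := by
  have hfloor := wilsonExpectation_plaquette_ge_linkBall (d := d) (L := L) ρ hd hN hρ hρU hβ hr p.1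
    (ne_of_lt p.2.2)
  have h := wilson_meanAccept_le_half_add_of_floor (d := d) (L := L) ρ hN hρ hρU hL β hε p he hs hQm hQ0
    hQb hQ1 hqm hq0 hqb hq1 hfac hy hqB hfloor
  have hNr : (0 : ℝ) < N := by exact_mod_cast hN
  have hd1 : (0 : ℝ) < (d : ℝ) - 1 := by
    have : (2 : ℝ) ≤ d := by exact_mod_cast hd
    linarith
  have e : (N : ℝ) * (1 - (1 - 8 * r ^ 2 / N +
        2 * Real.log ((haarProbability G).real {g : G | ‖ρ g - 1‖ ≤ r}) / (((d : ℝ) - 1) * N * β))) / ε ^ 2 =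
      (8 * r ^ 2 - 2 * Real.log ((haarProbability G).real {g : G | ‖ρ g - 1‖ ≤ r}) /
          (((d : ℝ) - 1) * β)) / ε ^ 2 := by
    field_simp
    ring
  rw [e] at h
  exact h

end Summit.Ventures.LatticeQCDFlow.Theory2.Autoregressive

end
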